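import Summits.BirchSwinnertonDyer.Rank1Residual.X11b.ShapiroPairs
import HarnessLib

/-!
# BSD rank-≤1 residual cell, class X9: `BSD(E,5)` by a SECOND method for the `5Ns` CERT pairs (rank 1, part C) — ONE exact `5`-descent certificate line each

HONEST FRAMING (cell `b2b-bsdres-*`, verbatim): the cell deletes COMBINATION-SHAPED residual classes of
the rank-≤1 BSD formula from PUBLISHED theorems only and TYPES the construction-shaped remainder; this
is not "finishing BSD". Class X9 stays TYPED at class level; everything here is PER PAIR; no lane
verdict is changed; no named fact; nothing is booked by this unit.

Unit `b2b-bsdres-x9`, gen 13 (rank 1, part C). Companion of `X9/ShapiroPairs.lean` (p229771: the five chain-only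
`5Ns` pairs; method, engine provenance and the generic consumer
`Summit.BirchSwinnertonDyer.Rank1Residual.X11b.bsdp_of_ainvs_of_card_selmerGroup` there and in
`X11b/ShapiroPairs.lean`; method note `HOME/b2b-bsdres-x11c/gen12/SHAPIRO5-METHOD.md`; the 48 JETCHEV–CHA
pairs closed flag-free the same way are in `X9/ShapiroPairsJetchev{RankZero,RankOneA,RankOneB}.lean`, gen 12).
This file (gen 13): the 2 X9 pairs (rank 1, part C) with image `5Ns` whose Heegner-index route of record in the X9
census (gens 5–11) is CERT — Heegner index prime to `5` on two engines, Cha 2005 / Miller 2011 Thm. 5.2,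
unflagged — and for which the EXACT Shapiro `5`-descent gives a SECOND, INDEPENDENT kernel route:
`#Sel^(5)(E/ℚ) = 5 ^ r_an` exactly (so `Ш(E/ℚ)[5] = 0`), `#Ш_an` a `5`-adic unit, GZK ⟹ `BSD(E,5)` —
with NO Heegner point, no index, no main-conjecture input. The two methods agree on every one of these
pairs (0 disagreements on the 121 X9 `5Ns` pairs carrying both, X9-CENSUS-G12 §1.2).
Run of record + independent verifier: kit job j105889 (gen 13) = the gen-12 engine (byte copies) + this unit's `S`-ENLARGEMENT
patch (`HOME/code/b2b-bsdres-x9/g13/jobS5e/`, diff in its README) on the three gen-12 aborts `5 ∣ #Cl_S(L)` (`131043s1`, `23104bp1`,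
`23104bq1`: all EXACT + VERIFIED now, `S` enlarged by the good prime `29`) and two regression controls (`608b1`, `351424bn1`: rows identical
to gen 12's); outputs `HOME/b2b-bsdres-x9/g13/desc5e/`. With this file the `5Ns` sub-family of X9 (`130` pairs of rank `≤ 1`) has an exact
descent line on EVERY pair. Pairs: `23104bp1`, `23104bq1`.
Non-kernel inputs per pair, displayed as binders: `hGZK` (Gross–Zagier–Kolyvagin, published),
`r_an ≤ 1` and `#Ш_an` (Cremona / the cell's engines), `hSel` (this certificate). Kernel-decided per
pair: `Δ ≠ 0`.
-/

set_option autoImplicit false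

noncomputable section

open scoped Classical

open WeierstrassCurve Literature.NumberTheory.EllipticCurves
  Literature.NumberTheory.EllipticCurves.Rank1Residual
  Literature.NumberTheory.EllipticCurves.Rank1Residual.Typed
  Summit.BirchSwinnertonDyer.Rank1Residual.X11b

namespace Summit.BirchSwinnertonDyer.Rank1Residual.X9

/-- **`BSD(E,5)` for `23104bp1`** (`N = 23104 = 2⁶·19²`, good ordinary at `5`, class X9; Cremona model `[0, 0, 0, -5054, -4156554]`; image `5Ns`,
Cartan field discriminant `-4`; rank `1`, `#Ш_an = 1`; c₂ = 1 (II), c₁₉ = 2 (I5*)). Heegner-index route of record: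
CERT (`D = -79`, `m = 4`, `5 ∤ m`, two engines; unflagged, gens 5–11). Here a SECOND, INDEPENDENT method for the same pair:
GZK and the certificate line `#Sel^(5)(E/ℚ) = 5 ^ r_an` (EXACT Shapiro `5`-descent, x11c gen-12 engine, byte copies, run +
verifier by unit `b2b-bsdres-x9` gen 13, kit job j105889 — the gen-12 run j103105 ABORTED on this curve at the engine's guard `5 ∣ #Cl_S(L)`;
gen 13's `S`-ENLARGEMENT patch (logic of x11c gen-13 `globalgens_enlarge`: add good primes lowering the `5`-part of `#Cl_S(L)`; here `S` = primes of `5N` `∪ {29}`,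
local condition at `29` = image of `E(ℚ₂₉)`) lifts it; `HOME/b2b-bsdres-x9/g13/desc5e/certs/cert_23104bp1.txt`): `[L:ℚ] = 8`,
`Cl(L) = [10, [10]]`, `#gens L(S,5) = 14`, `bnfcertify = 1`, `5`-saturation `[1, 46, 14]`, `dim H¹(ℚ, E[5]; S) = 2`,
**`dim_𝔽₅ Sel^(5)(E/ℚ) = 1`** with the generator's Kummer image spanning it; verifier: VERIFIED. Binders: `hGZK`, `r_an ≤ 1`, `#Ш_an` a `5`-adic unit, `hSel`.
[cite: Miller2011LMS, §1 and Def. 1.1] [cite: Cremona2006, Table 1 (Cremona label 23104bp1)] -/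
theorem bsdp_s23104bp1 (hGZK : rank_eq_analyticRank_of_analyticRank_le_one)
    (W : WeierstrassCurve ℚ) (hW : W = ⟨0, 0, 0, -5054, -4156554⟩)
    (hr : W.analyticRank ≤ 1) {q : ℚ} (hq : shaAn W = (q : ℂ)) (hv : padicValRat 5 q = 0)
    (hSel : Nat.card (W.selmerGroup (5 : ℤ)) = 5 ^ W.analyticRank) : BSDp W 5 := by
  subst hW
  haveI : Fact (Nat.Prime 5) := ⟨by norm_num⟩
  exact bsdp_of_ainvs_of_card_selmerGroup hGZK 0 0 0 (-5054) (-4156554) (by decide +kernel) 5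
    hr hq hv hSel

/-- **`BSD(E,5)` for `23104bq1`** (`N = 23104 = 2⁶·19²`, good ordinary at `5`, class X9; Cremona model `[0, 0, 0, -5054, 4156554]`; image `5Ns`,
Cartan field discriminant `-4`; rank `1`, `#Ш_an = 1`; c₂ = 1 (II), c₁₉ = 4 (I5*)). Heegner-index route of record:
CERT (`D = -79`, `m = 16`, `5 ∤ m`, two engines; unflagged, gens 5–11). Here a SECOND, INDEPENDENT method for the same pair:
GZK and the certificate line `#Sel^(5)(E/ℚ) = 5 ^ r_an` (EXACT Shapiro `5`-descent, x11c gen-12 engine, byte copies, run +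
verifier by unit `b2b-bsdres-x9` gen 13, kit job j105889 — the gen-12 run j103105 ABORTED on this curve at the engine's guard `5 ∣ #Cl_S(L)`;
gen 13's `S`-ENLARGEMENT patch (logic of x11c gen-13 `globalgens_enlarge`: add good primes lowering the `5`-part of `#Cl_S(L)`; here `S` = primes of `5N` `∪ {29}`,
local condition at `29` = image of `E(ℚ₂₉)`) lifts it; `HOME/b2b-bsdres-x9/g13/desc5e/certs/cert_23104bq1.txt`): `[L:ℚ] = 8`,
`Cl(L) = [10, [10]]`, `#gens L(S,5) = 14`, `bnfcertify = 1`, `5`-saturation `[1, 46, 14]`, `dim H¹(ℚ, E[5]; S) = 2`,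
**`dim_𝔽₅ Sel^(5)(E/ℚ) = 1`** with the generator's Kummer image spanning it; verifier: VERIFIED. Binders: `hGZK`, `r_an ≤ 1`, `#Ш_an` a `5`-adic unit, `hSel`.
[cite: Miller2011LMS, §1 and Def. 1.1] [cite: Cremona2006, Table 1 (Cremona label 23104bq1)] -/
theorem bsdp_s23104bq1 (hGZK : rank_eq_analyticRank_of_analyticRank_le_one)
    (W : WeierstrassCurve ℚ) (hW : W = ⟨0, 0, 0, -5054, 4156554⟩)
    (hr : W.analyticRank ≤ 1) {q : ℚ} (hq : shaAn W = (q : ℂ)) (hv : padicValRat 5 q = 0)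
    (hSel : Nat.card (W.selmerGroup (5 : ℤ)) = 5 ^ W.analyticRank) : BSDp W 5 := by
  subst hW
  haveI : Fact (Nat.Prime 5) := ⟨by norm_num⟩
  exact bsdp_of_ainvs_of_card_selmerGroup hGZK 0 0 0 (-5054) 4156554 (by decide +kernel) 5
    hr hq hv hSel

end Summit.BirchSwinnertonDyer.Rank1Residual.X9

end
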